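import Mathlib
import HarnessLib
import Summits.HubbardSuperconductivity.HubbardSuperconductivity.Theorems.KLProgrammeKLRegimeSymbolFrameInstanceSingle
import Summits.HubbardSuperconductivity.HubbardSuperconductivity.Theorems.KLProgrammeKLRegimeSymbolFrameInstanceSinglePadded
import Summits.HubbardSuperconductivity.HubbardSuperconductivity.Theorems.KLProgrammeKLRegimeSymbolSampledThirdZone
import Summits.HubbardSuperconductivity.HubbardSuperconductivity.Theorems.KLProgrammeKLRegimeSymbolFrameProfileThird
import Summits.HubbardSuperconductivity.HubbardSuperconductivity.Theorems.KLProgrammeH10TwoPointLimitSymbolProductSampledZone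
import Summits.HubbardSuperconductivity.HubbardSuperconductivity.Theorems.KLProgrammeH10TwoPointLimitSectorMultiplierSupport

/-!
# Route `KLProgramme` — engine support, route (L2): the POINTWISE differences of the PADDED SINGLE-multiplier symbol `F_ω(k)` (`klAnisoFamily` at
# scale `n` on an admissible frame, on the `4M`-grid `(ℤ/4M) × (ℤ/L)²` of the engine's torus sums) — THIRD differences in time and along any integer spatial step at the ISOTROPIC rate (`C³` band data), SECOND
# differences along a step with a tangency datum (`C²` data) — and its support count: the inputs of `torusSumWt_le_of_symbol_bounds_mixed`

Cell `gate-hubbard-kl`, seat p3 (g10); the one-factor / mixed-order twin of p4's `…H10TwoPointLimitSectorMultiplierDiffs` + `…Support`, for W1 of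
the (E4)ₙ supply of stmt-HubbardSuperconductivity-20437 (located risk «(b)-Wt@j≥1», cure W1-MIXED).  For the padded sampled symbol `G̃(q) = F_ω(k(q))` (`0` beyond the kept block) on
`(ℤ/4Mℤ)¹ × (ℤ/Lℤ)²` (profile `Gₙ`, band `e_K ∘ toLp` with `‖D²‖ ≤ 4 + 4A`, `‖D³‖ ≤ 4 + 8A₃`, one-factor angular factor `Z`):

* `norm_klAnisoPadded_le_one`;
* **`norm_fwdDiff_three_time_klAnisoPadded_le`** — `‖Δ³_{(1,0)} G̃(q)‖ ≤ (8g₃ + 12g₂)(2π/β)³/Λ_n³` (`Λ_nβ < π(2M−5)`; `g₂ = d e₀⁴`, `g₃ = d e₀⁶`);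
* **`norm_fwdDiff_three_space_klAnisoPadded_le`** — for an integer step `u` with `6π|u_j| ≤ zL`, with `w = 2πu/L`, `τ = (4+2A)‖w‖`, `K₂ = 4+4A`, `K₃ = 4+8A₃`,
  `D = (1 + 6/w_n)‖w₁ + iw₂‖`, `g₁ = d e₀²`: the isotropic order-three bound of `…SymbolSampledThirdZone` for EVERY `q`;
* **`norm_fwdDiff_two_space_klAnisoPadded_le`** — the order-two bound with a tangency datum `|De_K(p_F)w| ≤ τ₀` at `p_F = klFermiPoint μ K θ_{n,ω}`
  (`τ₂ = τ₀ + K₂(ρ + 2‖w‖)‖w‖`, `ρ` the cell radius) — p4's `norm_fwdDiff_two_space_sampledSymbol_le'` on the one-factor instance;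
* **`card_support_klAnisoPadded_le`** — `#{G̃ ≠ 0} ≤ (Λ_nβ/π + 1)(√2L(Λ_n + (4+4A)ρ²)/(γπ) + 2)(2√2Lρ/π + 2)`, `γ = 2ρ_min − 4A`.

Everything is proved; no definitions, no named facts. [folklore]  (BGM 2006 §2.5 Lemma 2.2 (2.52)–(2.56).)
-/

noncomputable section

namespace Summit.HubbardSuperconductivity.HubbardSuperconductivity.Theorems.TorusFourierL2

set_option linter.dupNamespace false -- summit = problem name (single-conjunct summit), D-0017

open Set Finset Literature.MathematicalPhysics.QuantumLattice Literature.MathematicalPhysics.QuantumLattice.BandSectorCounting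
open Literature.MathematicalPhysics.QuantumLattice.FermiRG Literature.Probability.LatticeModels Literature.Analysis.SpecialFunctions
open Summit.HubbardSuperconductivity.HubbardSuperconductivity.Theorems.DispersionFlow
open Summit.HubbardSuperconductivity.HubbardSuperconductivity.Theorems.KLRegimeSplit
open Summit.HubbardSuperconductivity.HubbardSuperconductivity.Theorems.KLProgrammeLegKernels
open Summit.HubbardSuperconductivity.HubbardSuperconductivity.Theorems.PerturbedFermiCurve
open scoped Real

section Single

variable {L M : ℕ} [NeZero L] [NeZero M] {a b : ℝ} (B : BandBounds a b) {K : TrigPolyC4v} {A A₃ : ℝ}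
  (hA : ∀ p : Momentum, ∀ j ≤ 2, ‖iteratedFDeriv ℝ j (frameShift K) p‖ ≤ A) (hADt : 2 * A < B.Dtmin)
  (hA3 : ∀ p : Momentum, ‖iteratedFDeriv ℝ 3 (frameShift K) p‖ ≤ A₃)
  {μ e₀ z β : ℝ} (he : 0 < e₀) (hz : 0 < z) (hz1 : z ≤ 1) (hgap : e₀ + A + z ^ 2 < -μ) (h3 : e₀ + A - μ ≤ 3)
  (hlo : a ≤ μ - A - e₀) (hhi : μ + A + e₀ ≤ b) (hβ : 0 < β) (hρA : 4 * A < 2 * B.rhomin)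
  {n : ℕ} (ω : Fin (sectorCount n))
  {d : ℝ} (hd : 0 ≤ d) (hd1 : ∀ u, |deriv (bgmCutoffSq e₀) u| ≤ d) (hd2 : ∀ u, |iteratedDeriv 2 (bgmCutoffSq e₀) u| ≤ d)
  (hd3 : ∀ u, |iteratedDeriv 3 (bgmCutoffSq e₀) u| ≤ d)
  {Z : (Fin 2 → ℝ) → ℝ}
  (hZ : ∀ p, Z p = gnCutoff ((π + z) ^ 2 / π ^ 2) ((π + z) ^ 2) (p 0 ^ 2) * gnCutoff ((π + z) ^ 2 / π ^ 2) ((π + z) ^ 2) (p 1 ^ 2) *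
    (radialCutoffC (1 / 2) (momToComplex p) * sectorWeightCirc n ((ω : ℕ) : ℤ) (polarAngle p)))
  {Φ : ℝ × (Fin 2 → ℝ) → ℂ}
  (hΦ : ∀ k₀ p, Φ (k₀, p) = ((bgmCutoffSq e₀ ((16 : ℝ) ^ n * (k₀ ^ 2 + frameLevel μ K (WithLp.toLp 2 p) ^ 2)) * Z p : ℝ) : ℂ))
  {Gs : TorusSite 1 (2 * (2 * M)) × TorusSite 2 L → ℂ}
  (hGs : ∀ q, Gs q = if h : (q.1 0).val < 2 * M then klAnisoFamily L M β μ K e₀ n ω (⟨(q.1 0).val, h⟩, q.2) else 0)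
  (hM3 : klScale e₀ n * β < π * (2 * M - 3))

include hZ hΦ hGs hA he hz h3 hβ hM3 in
omit [NeZero M] in
/-- **`‖G̃‖ ≤ 1`.** [folklore] -/
theorem norm_klAnisoPadded_le_one (q : TorusSite 1 (2 * (2 * M)) × TorusSite 2 L) : ‖Gs q‖ ≤ 1 := by
  rw [klAniso_padded_eq_symbol hA he hz h3 hβ ω hZ hΦ hGs hM3 q, hΦ, Complex.norm_real, Real.norm_eq_abs, abs_mul]
  have h1 := abs_bgmCutoffSq_le_one e₀ ((16 : ℝ) ^ n * ((π * (1 - 2 * M) / β + 2 * π / β * (((q.1 0).val : ℕ) : ℝ)) ^ 2 +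
    frameLevel μ K (WithLp.toLp 2 fun j => 2 * π / L * (((q.2 j).valMinAbs : ℤ) : ℝ)) ^ 2))
  have h2 := (angularFactor₁_smooth_abs_zone hZ hz).2.1 (fun j => 2 * π / L * (((q.2 j).valMinAbs : ℤ) : ℝ))
  calc _ ≤ 1 * 1 := mul_le_mul h1 h2 (abs_nonneg _) zero_le_one
    _ = 1 := by norm_num

include hA he hz h3 hβ hM3 hd1 hd2 hd3 hZ hΦ hGs in
/-- **Time direction, order three**: `‖Δ³_{(1,0)} G̃(q)‖ ≤ (8g₃ + 12g₂)(2π/β)³/Λ_n³` for every `q`, provided `Λ_nβ < π(2M − 5)`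
(`g₂ = d e₀⁴`, `g₃ = d e₀⁶`). [cite: BenfattoGiulianiMastropietro2006, §2.5 Lemma 2.2 (2.52), (2.56)] -/
theorem norm_fwdDiff_three_time_klAnisoPadded_le (hM : klScale e₀ n * β < π * (2 * M - 5)) (q : TorusSite 1 (2 * (2 * M)) × TorusSite 2 L) :
    ‖((fwdDiff ((fun _ : Fin 1 => (1 : ZMod (2 * (2 * M)))), (0 : TorusSite 2 L)))^[3] Gs) q‖ ≤
      (8 * (d * e₀ ^ 6) + 12 * (d * e₀ ^ 4)) * |2 * π / β| ^ 3 * 1 / klScale e₀ n ^ 3 := by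
  obtain ⟨hGc, -, hG1, hG2, hG3, hGv⟩ := scaleProfile_bounds₃ he n hd1 hd2 hd3
  have hΛ : 0 < klScale e₀ n := by rw [klScale]; positivity
  have hd0 : 0 ≤ d := le_trans (abs_nonneg _) (hd1 0)
  exact norm_fwdDiff_three_time_sampledSymbol_le hGc hΛ (by positivity) (by positivity) (by positivity) hG1 hG2 hG3 hGv
    (fun p : Fin 2 → ℝ => frameLevel μ K (WithLp.toLp 2 p)) Z ((angularFactor₁_smooth_abs_zone hZ hz).2.1) Φ (fun k₀ p => hΦ k₀ p)
    (π * (1 - 2 * M) / β) (2 * π / β) (2 * π / L) (fun m hm => symbol_window₃_padded hβ hM m hm) Gs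
    (klAniso_padded_eq_symbol hA he hz h3 hβ ω hZ hΦ hGs hM3) q

include hA he hz hz1 hgap h3 hZ in
/-- Points of the enlarged square `|p_i| ≤ π + z` in the shell `|e_K| ≤ Λ_n` are in the OPEN square and in the Fermi region. [folklore] -/
theorem inner_of_square_shell (p : Fin 2 → ℝ) (hsq : ∀ i, |p i| ≤ π + z) (hshell : |frameLevel μ K (WithLp.toLp 2 p)| ≤ klScale e₀ n) :
    (∀ i, |p i| < π) ∧ 1 ≤ ‖momToComplex p‖ := by
  have hΛe : klScale e₀ n ≤ e₀ := klScale_le_e0 he.le n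
  have _ := hZ
  have _ := hz
  refine ⟨fun i => ?_, one_le_norm_of_frameBand_le hA h3 (hshell.trans hΛe)⟩
  by_contra hge
  push Not at hge
  have h1 : π - z ≤ |p i| := by linarith
  have := frameBand_zone hA hz1 hgap h1 (hsq i)
  exact absurd (hshell.trans hΛe) (not_le.2 this)

include hA hA3 he hz hz1 hgap h3 hβ hM3 hd hd1 hd2 hd3 hZ hΦ hGs in
/-- **Space direction, order three, isotropic form** along an integer step `u` with `6π|u_j| ≤ zL` (`w = 2πu/L`): with the angular constant `B_a` of
`exists_norm_iteratedDeriv_sectorWeightCirc_polarAngle_line_le 3`, `τ = (4+2A)‖w‖`, `K₂ = 4+4A`, `K₃ = 4+8A₃`, `D = (1+6/w_n)‖w₁+iw₂‖`,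
`g₁ = de₀²`, `g₂ = de₀⁴`, `g₃ = de₀⁶`: for EVERY `q`,
`‖Δ³_{(0,ū)} G̃(q)‖ ≤ [(8g₃+12g₂)τ³/Λ³ + (12g₂+6g₁)τK₂‖w‖²/Λ² + 2g₁K₃‖w‖³/Λ]·1 + 3[(4g₂+2g₁)τ²/Λ² + 2g₁K₂‖w‖²/Λ]·6B_aD + 3(2g₁τ/Λ)·6B_aD² + 6B_aD³`.
[cite: BenfattoGiulianiMastropietro2006, §2.5 Lemma 2.2 (2.53)–(2.55)] -/
theorem norm_fwdDiff_three_space_klAnisoPadded_le {Ba : ℝ} (hB0 : 0 ≤ Ba)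
    (hB : ∀ (i : ℕ), i ≤ 3 → ∀ (n : ℕ) (ω : ℤ) (θ₀ : ℝ) (q w : Fin 2 → ℝ) (t : ℝ) {r₀ : ℝ}, 0 < r₀ →
      r₀ ≤ ‖momToComplex (q + t • w)‖ → |sectorRelAngle θ₀ (q + t • w)| < π →
      ‖iteratedDeriv i (fun t : ℝ => sectorWeightCirc n ω (polarAngle (q + t • w))) t‖ ≤
        (3 : ℕ).factorial * Ba * ((1 + (sectorWidth n)⁻¹ * (3 : ℕ).factorial) * ‖momToComplex w‖ / r₀) ^ i)
    (u : Fin 2 → ℤ) (hu : ∀ j, 3 * |2 * π / L| * |(u j : ℝ)| ≤ z) (q : TorusSite 1 (2 * (2 * M)) × TorusSite 2 L) :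
    ‖((fwdDiff ((0 : TorusSite 1 (2 * (2 * M))), (fun j => ((u j : ℤ) : ZMod L))))^[3] Gs) q‖ ≤
      ((8 * (d * e₀ ^ 6) + 12 * (d * e₀ ^ 4)) * ((4 + 2 * A) * ‖(fun j => 2 * π / L * (u j : ℝ))‖) ^ 3 / klScale e₀ n ^ 3 +
          (12 * (d * e₀ ^ 4) + 6 * (d * e₀ ^ 2)) *
            (((4 + 2 * A) * ‖(fun j => 2 * π / L * (u j : ℝ))‖) * ((4 + 4 * A) * ‖(fun j => 2 * π / L * (u j : ℝ))‖ ^ 2)) /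
              klScale e₀ n ^ 2 +
          2 * (d * e₀ ^ 2) * ((4 + 8 * A₃) * ‖(fun j => 2 * π / L * (u j : ℝ))‖ ^ 3) / klScale e₀ n) * 1 +
        3 * (((4 * (d * e₀ ^ 4) + 2 * (d * e₀ ^ 2)) * ((4 + 2 * A) * ‖(fun j => 2 * π / L * (u j : ℝ))‖) ^ 2 / klScale e₀ n ^ 2 +
              2 * (d * e₀ ^ 2) * ((4 + 4 * A) * ‖(fun j => 2 * π / L * (u j : ℝ))‖ ^ 2) / klScale e₀ n) *
            (6 * Ba * ((1 + 6 * (sectorWidth n)⁻¹) * ‖momToComplex (fun j => 2 * π / L * (u j : ℝ))‖))) +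
        3 * (2 * (d * e₀ ^ 2) * ((4 + 2 * A) * ‖(fun j => 2 * π / L * (u j : ℝ))‖) / klScale e₀ n *
            (6 * Ba * ((1 + 6 * (sectorWidth n)⁻¹) * ‖momToComplex (fun j => 2 * π / L * (u j : ℝ))‖) ^ 2)) +
        1 * (6 * Ba * ((1 + 6 * (sectorWidth n)⁻¹) * ‖momToComplex (fun j => 2 * π / L * (u j : ℝ))‖) ^ 3) := by
  obtain ⟨hGc, hG0, hG1, hG2, hG3, hGv⟩ := scaleProfile_bounds₃ he n hd1 hd2 hd3
  have hΛ : 0 < klScale e₀ n := by rw [klScale]; positivity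
  have hL : (0 : ℝ) < L := Nat.cast_pos.2 (Nat.pos_of_ne_zero (NeZero.ne L))
  set w : Fin 2 → ℝ := fun j => 2 * π / L * (u j : ℝ) with hw
  set eK : (Fin 2 → ℝ) → ℝ := fun p => frameLevel μ K (WithLp.toLp 2 p) with heK
  have hD : 0 ≤ (1 + 6 * (sectorWidth n)⁻¹) * ‖momToComplex w‖ := by have := sectorWidth_pos n; positivity
  obtain ⟨hZc, hZabs, -⟩ := angularFactor₁_smooth_abs_zone hZ hz
  have hZ1 : ∀ (p₀ : Fin 2 → ℝ) (s : ℝ), (∀ i, |(p₀ + s • w) i| ≤ π + z) → |eK (p₀ + s • w)| ≤ klScale e₀ n →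
      |deriv (fun s : ℝ => Z (p₀ + s • w)) s| ≤ 6 * Ba * ((1 + 6 * (sectorWidth n)⁻¹) * ‖momToComplex w‖) := by
    intro p₀ s hsq hshell
    obtain ⟨hin, hfermi⟩ := inner_of_square_shell hA he hz hz1 hgap h3 ω hZ _ hsq hshell
    exact (abs_derivs_angularFactor₁_line_le hz hZ hB p₀ w hin hfermi).1
  have hZ2 : ∀ (p₀ : Fin 2 → ℝ) (s : ℝ), (∀ i, |(p₀ + s • w) i| ≤ π + z) → |eK (p₀ + s • w)| ≤ klScale e₀ n →
      |iteratedDeriv 2 (fun s : ℝ => Z (p₀ + s • w)) s| ≤ 6 * Ba * ((1 + 6 * (sectorWidth n)⁻¹) * ‖momToComplex w‖) ^ 2 := by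
    intro p₀ s hsq hshell
    obtain ⟨hin, hfermi⟩ := inner_of_square_shell hA he hz hz1 hgap h3 ω hZ _ hsq hshell
    exact (abs_derivs_angularFactor₁_line_le hz hZ hB p₀ w hin hfermi).2.1
  have hZ3 : ∀ (p₀ : Fin 2 → ℝ) (s : ℝ), (∀ i, |(p₀ + s • w) i| ≤ π + z) → |eK (p₀ + s • w)| ≤ klScale e₀ n →
      |iteratedDeriv 3 (fun s : ℝ => Z (p₀ + s • w)) s| ≤ 6 * Ba * ((1 + 6 * (sectorWidth n)⁻¹) * ‖momToComplex w‖) ^ 3 := by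
    intro p₀ s hsq hshell
    obtain ⟨hin, hfermi⟩ := inner_of_square_shell hA he hz hz1 hgap h3 ω hZ _ hsq hshell
    exact (abs_derivs_angularFactor₁_line_le hz hZ hB p₀ w hin hfermi).2.2
  have hxL : |2 * π / (L : ℝ)| * L = 2 * π := by rw [abs_of_pos (by positivity)]; field_simp
  have hτ : ∀ p : Fin 2 → ℝ, |fderiv ℝ eK p w| ≤ (4 + 2 * A) * ‖w‖ := fun p => abs_fderiv_frameBand_apply_le hA μ p w
  exact norm_fwdDiff_three_space_sampledSymbol_le' hGc hΛ zero_le_one (by positivity) (by positivity) (by positivity) hG0 hG1 hG2 hG3 hGv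
    (contDiff_three_frameBand μ K) (norm_iteratedFDeriv_two_frameBand_le hA μ) (norm_iteratedFDeriv_three_frameBand_le hA3 μ) w hτ
    (hZc 3) zero_le_one (by positivity) (by positivity) (by positivity) hZabs hZ1 hZ2 hZ3
    Φ (fun k₀ p => hΦ k₀ p) (π * (1 - 2 * M) / β) (2 * π / β) (2 * π / L) u rfl hu
    (fun k₀ p hp => (symbol₁_vanish hA he hz hz1 hgap ω hZ hΦ).1 k₀ p hp) hxL Gs
    (klAniso_padded_eq_symbol hA he hz h3 hβ ω hZ hΦ hGs hM3) q

include B hA hADt he hz hz1 hgap h3 hlo hhi hβ hM3 hd hd1 hd2 hZ hΦ hGs in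
/-- **Space direction, order two, with a tangency datum** `|De_K(p_F)w| ≤ τ₀` at the cell's Fermi point `p_F = klFermiPoint μ K θ_{n,ω}` along an
integer step `u` (`w = (2π/L)u`, `4π|u_j| ≤ zL`), with the angular constant `B_a` of `exists_norm_iteratedDeriv_sectorWeightCirc_polarAngle_line_le 3`:
for EVERY `q`, `‖Δ²_{(0,ū)} G̃(q)‖ ≤ ((4g₂+2g₁)τ₂²/Λ² + 2g₁K₂‖w‖²/Λ)·1 + 4g₁τ₂/Λ·6B_aD + 1·6B_aD²`, `τ₂ = τ₀ + K₂(ρ + 2‖w‖)‖w‖`,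
`ρ = (Λ_n + s_max Dt_min(3w_n/4))/(Dt_min − 2A)`. [cite: BenfattoGiulianiMastropietro2006, §2.5 Lemma 2.2 (2.53)–(2.55)] -/
theorem norm_fwdDiff_two_space_klAnisoPadded_le {Ba : ℝ} (hB0 : 0 ≤ Ba)
    (hB : ∀ (i : ℕ), i ≤ 3 → ∀ (n : ℕ) (ω : ℤ) (θ₀ : ℝ) (q w : Fin 2 → ℝ) (t : ℝ) {r₀ : ℝ}, 0 < r₀ →
      r₀ ≤ ‖momToComplex (q + t • w)‖ → |sectorRelAngle θ₀ (q + t • w)| < π →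
      ‖iteratedDeriv i (fun t : ℝ => sectorWeightCirc n ω (polarAngle (q + t • w))) t‖ ≤
        (3 : ℕ).factorial * Ba * ((1 + (sectorWidth n)⁻¹ * (3 : ℕ).factorial) * ‖momToComplex w‖ / r₀) ^ i)
    (u : Fin 2 → ℤ) (hu : ∀ j, 2 * |2 * π / L| * |(u j : ℝ)| ≤ z) {τ₀ : ℝ}
    (hτ₀ : |fderiv ℝ (fun p : Fin 2 → ℝ => frameLevel μ K (WithLp.toLp 2 p)) (klFermiPoint μ K (sectorCenter n (ω : ℕ)))
      (fun j => 2 * π / L * (u j : ℝ))| ≤ τ₀)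
    (q : TorusSite 1 (2 * (2 * M)) × TorusSite 2 L) :
    ‖((fwdDiff ((0 : TorusSite 1 (2 * (2 * M))), (fun j => ((u j : ℤ) : ZMod L))))^[2] Gs) q‖ ≤
      ((4 * (d * e₀ ^ 4) + 2 * (d * e₀ ^ 2)) *
          (τ₀ + (4 + 4 * A) * ((klScale e₀ n + B.smax * B.Dtmin * (3 * sectorWidth n / 4)) / (B.Dtmin - 2 * A) +
            2 * ‖(fun j => 2 * π / L * (u j : ℝ))‖) * ‖(fun j => 2 * π / L * (u j : ℝ))‖) ^ 2 / klScale e₀ n ^ 2 +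
          2 * (d * e₀ ^ 2) * ((4 + 4 * A) * ‖(fun j => 2 * π / L * (u j : ℝ))‖ ^ 2) / klScale e₀ n) * 1 +
        4 * (d * e₀ ^ 2) *
          (τ₀ + (4 + 4 * A) * ((klScale e₀ n + B.smax * B.Dtmin * (3 * sectorWidth n / 4)) / (B.Dtmin - 2 * A) +
            2 * ‖(fun j => 2 * π / L * (u j : ℝ))‖) * ‖(fun j => 2 * π / L * (u j : ℝ))‖) / klScale e₀ n *
          (6 * Ba * ((1 + 6 * (sectorWidth n)⁻¹) * ‖momToComplex (fun j => 2 * π / L * (u j : ℝ))‖)) +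
        1 * (6 * Ba * ((1 + 6 * (sectorWidth n)⁻¹) * ‖momToComplex (fun j => 2 * π / L * (u j : ℝ))‖) ^ 2) := by
  obtain ⟨hGc, hG0, hG1, hG2, hGv⟩ := scaleProfile_bounds he n hd1 hd2
  have hΛ : 0 < klScale e₀ n := by rw [klScale]; positivity
  have hL : (0 : ℝ) < L := Nat.cast_pos.2 (Nat.pos_of_ne_zero (NeZero.ne L))
  set w : Fin 2 → ℝ := fun j => 2 * π / L * (u j : ℝ) with hw
  set eK : (Fin 2 → ℝ) → ℝ := fun p => frameLevel μ K (WithLp.toLp 2 p) with heK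
  have hDt : 0 < B.Dtmin - 2 * A := by linarith
  have hρ : 0 ≤ (klScale e₀ n + B.smax * B.Dtmin * (3 * sectorWidth n / 4)) / (B.Dtmin - 2 * A) := by
    have := B.smax_pos; have := B.Dtmin_pos; have := sectorWidth_pos n; positivity
  have hD : 0 ≤ (1 + 6 * (sectorWidth n)⁻¹) * ‖momToComplex w‖ := by have := sectorWidth_pos n; positivity
  obtain ⟨hZc, hZabs, -⟩ := angularFactor₁_smooth_abs_zone hZ hz
  have hZ1 : ∀ (p₀ : Fin 2 → ℝ) (s : ℝ), (∀ i, |(p₀ + s • w) i| ≤ π + z) → |eK (p₀ + s • w)| ≤ klScale e₀ n →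
      |deriv (fun s : ℝ => Z (p₀ + s • w)) s| ≤ 6 * Ba * ((1 + 6 * (sectorWidth n)⁻¹) * ‖momToComplex w‖) := by
    intro p₀ s hsq hshell
    obtain ⟨hin, hfermi⟩ := inner_of_square_shell hA he hz hz1 hgap h3 ω hZ _ hsq hshell
    exact (abs_derivs_angularFactor₁_line_le hz hZ hB p₀ w hin hfermi).1
  have hZ2 : ∀ (p₀ : Fin 2 → ℝ) (s : ℝ), (∀ i, |(p₀ + s • w) i| ≤ π + z) → |eK (p₀ + s • w)| ≤ klScale e₀ n →
      |iteratedDeriv 2 (fun s : ℝ => Z (p₀ + s • w)) s| ≤ 6 * Ba * ((1 + 6 * (sectorWidth n)⁻¹) * ‖momToComplex w‖) ^ 2 := by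
    intro p₀ s hsq hshell
    obtain ⟨hin, hfermi⟩ := inner_of_square_shell hA he hz hz1 hgap h3 ω hZ _ hsq hshell
    exact (abs_derivs_angularFactor₁_line_le hz hZ hB p₀ w hin hfermi).2.1
  have hxL : |2 * π / (L : ℝ)| * L = 2 * π := by rw [abs_of_pos (by positivity)]; field_simp
  exact norm_fwdDiff_two_space_sampledSymbol_le' hGc hΛ zero_le_one (by positivity) (by positivity) hG0 hG1 hG2 hGv
    (contDiff_frameBand μ K) (norm_iteratedFDeriv_two_frameBand_le hA μ) (hZc 2) zero_le_one (by positivity) (by positivity) hZabs w hZ1 hZ2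
    hρ hτ₀ (fun p hsq hshell hZp => symbol₁_cell B hA hADt he hz hz1 hgap hlo hhi ω hZ p hsq hshell hZp)
    Φ (fun k₀ p => hΦ k₀ p) (π * (1 - 2 * M) / β) (2 * π / β) (2 * π / L) u rfl hu
    (fun k₀ p hp => (symbol₁_vanish hA he hz hz1 hgap ω hZ hΦ).1 k₀ p hp) hxL Gs
    (klAniso_padded_eq_symbol hA he hz h3 hβ ω hZ hΦ hGs hM3) q

include B hA hADt he hz hz1 hgap h3 hlo hhi hβ hM3 hρA hd1 hd2 hZ hΦ hGs in
/-- **Support count of the single-multiplier symbol**: time window × rotated box,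
`#{G̃ ≠ 0} ≤ (Λ_nβ/π + 1)·(√2 L (Λ_n + (4+4A)ρ²)/(γπ) + 2)(√2 L (2ρ)/π + 2)`, `γ = 2ρ_min − 4A`, `ρ = (Λ_n + s_max Dt_min (3w_n/4))/(Dt_min − 2A)`.
[cite: BenfattoGiulianiMastropietro2006, §2.5 (2.46)–(2.50)] -/
theorem card_support_klAnisoPadded_le [DecidablePred fun q : TorusSite 1 (2 * (2 * M)) × TorusSite 2 L => Gs q ≠ 0] :
    (((univ : Finset (TorusSite 1 (2 * (2 * M)) × TorusSite 2 L)).filter fun q => Gs q ≠ 0).card : ℝ) ≤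
      (klScale e₀ n * β / π + 1) *
        ((Real.sqrt 2 * L * ((klScale e₀ n + (4 + 4 * A) *
            ((klScale e₀ n + B.smax * B.Dtmin * (3 * sectorWidth n / 4)) / (B.Dtmin - 2 * A)) ^ 2) / (2 * B.rhomin - 4 * A)) / π + 2) *
          (Real.sqrt 2 * L * (2 * ((klScale e₀ n + B.smax * B.Dtmin * (3 * sectorWidth n / 4)) / (B.Dtmin - 2 * A))) / π + 2)) := by
  classical
  obtain ⟨-, -, -, -, hGv⟩ := scaleProfile_bounds he n hd1 hd2
  have hΛ : 0 < klScale e₀ n := by rw [klScale]; positivity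
  have hL : (0 : ℝ) < L := Nat.cast_pos.2 (Nat.pos_of_ne_zero (NeZero.ne L))
  have hπ := Real.pi_pos
  have hxL : |2 * π / (L : ℝ)| * L = 2 * π := by rw [abs_of_pos (by positivity)]; field_simp
  set ρ : ℝ := (klScale e₀ n + B.smax * B.Dtmin * (3 * sectorWidth n / 4)) / (B.Dtmin - 2 * A) with hρdef
  have hρ0 : 0 ≤ ρ := by
    have := B.smax_pos; have := B.Dtmin_pos; have := sectorWidth_pos n
    have : 0 < B.Dtmin - 2 * A := by linarith
    positivity
  set pF : Fin 2 → ℝ := klFermiPoint μ K (sectorCenter n (ω : ℕ)) with hpF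
  set eK : (Fin 2 → ℝ) → ℝ := fun p => frameLevel μ K (WithLp.toLp 2 p) with heK
  have hcount := card_support_sampledSymbol_le (P := 2 * (2 * M)) (L := L) hΛ hGv eK Z (pF := pF) (ρ := ρ) hz.le
    (fun p hsq hshell hZp => symbol₁_cell B hA hADt he hz hz1 hgap hlo hhi ω hZ p hsq hshell hZp)
    Φ (fun k₀ p => hΦ k₀ p) (π * (1 - 2 * M) / β) (2 * π / β) (2 * π / L) hxL Gs
    (klAniso_padded_eq_symbol hA he hz h3 hβ ω hZ hΦ hGs hM3)
  have hT : (((univ : Finset (TorusSite 1 (2 * (2 * M)))).filter fun i =>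
      |π * (1 - 2 * M) / β + 2 * π / β * (((i 0).val : ℕ) : ℝ)| ≤ klScale e₀ n).card : ℝ) ≤ klScale e₀ n * β / π + 1 := by
    have h := card_filter_timeWindow_le (P := 2 * (2 * M)) (a₀ := π * (1 - 2 * M) / β) (h₀ := 2 * π / β) (Λ := klScale e₀ n)
      (by positivity) hΛ.le
    refine h.trans (le_of_eq ?_)
    field_simp
  have hlo' : a ≤ μ - A := by linarith
  have hhi' : μ + A ≤ b := by linarith
  have hγ : 0 < 2 * B.rhomin - 4 * A := by linarith
  have hX : (((univ : Finset (TorusSite 2 L)).filter fun k =>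
      |eK (fun j => 2 * π / L * (((k j).valMinAbs : ℤ) : ℝ))| ≤ klScale e₀ n ∧
        ‖(fun j => 2 * π / L * (((k j).valMinAbs : ℤ) : ℝ)) - pF‖ ≤ ρ).card : ℝ) ≤
      (Real.sqrt 2 * L * ((klScale e₀ n + (4 + 4 * A) * ρ ^ 2) / (2 * B.rhomin - 4 * A)) / π + 2) *
        (Real.sqrt 2 * L * (2 * ρ) / π + 2) := by
    refine card_filter_cell_le L (contDiff_frameBand μ K) (norm_iteratedFDeriv_two_frameBand_le hA μ)
      (pF := pF) (frameLevel_klFermiPoint B hA hlo' hhi' (sectorCenter n (ω : ℕ))) hΛ.le hρ0 hγ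
      (gradient_floor_klFermiPoint B hA hlo' hhi' (sectorCenter n (ω : ℕ))) _ ?_
    intro k hk
    obtain ⟨h1, h2⟩ := (Finset.mem_filter.1 hk).2
    have e : (fun j => 2 * π * (((k j).valMinAbs : ℤ) : ℝ) / L) = fun j => 2 * π / L * (((k j).valMinAbs : ℤ) : ℝ) :=
      funext fun j => by ring
    rw [e]; exact ⟨h1, h2⟩
  calc _ ≤ ((((univ : Finset (TorusSite 1 (2 * (2 * M)))).filter fun i =>
        |π * (1 - 2 * M) / β + 2 * π / β * (((i 0).val : ℕ) : ℝ)| ≤ klScale e₀ n).card *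
        ((univ : Finset (TorusSite 2 L)).filter fun k =>
          |eK (fun j => 2 * π / L * (((k j).valMinAbs : ℤ) : ℝ))| ≤ klScale e₀ n ∧
            ‖(fun j => 2 * π / L * (((k j).valMinAbs : ℤ) : ℝ)) - pF‖ ≤ ρ).card : ℕ) : ℝ) := by exact_mod_cast hcount
    _ ≤ _ := by
        push_cast
        exact mul_le_mul hT hX (Nat.cast_nonneg _) (by positivity)

end Single

end Summit.HubbardSuperconductivity.HubbardSuperconductivity.Theorems.TorusFourierL2

end
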